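import Mathlib
import Literature.MathematicalPhysics.MHD.HainLustSigmaStability
import Summits.Ventures.FusionMHD.Models.TearingFRS1SigmaAll
import HarnessLib

/-!
# F3.σ ★ #72 LIMIT FORM: the `(2,1)` mode of the FRS1 equilibrium (MODEL M of row #54) satisfies the ideal ENERGY PRINCIPLE `W ≥ 0` —
# the `σ → 0` end of «σ-stable for every σ ≠ 0»

LADDER-GRIDFUSION rung F3; a COROLLARY file of `Models/TearingFRS1SigmaAll.lean` (★ #72 «F3.σ-FRS1-IDEAL21-ALLSIGMA», seat `gridfusion-sos-6`
g4: `Sigma.sigmaModifiedEnergy_pos_all` — `W + σ²I > 0` for EVERY `σ ≠ 0` and every class-C displacement of the mode `(m, k) = (2, −1/5)` of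
MODEL M = `Sigma.dyn`, the Hain–Lüst single-mode model of the FRS1 equilibrium, `p ≡ 0`, `R₀ = 5a` MODELLED, wall AT the plasma).  Seat
`gridfusion-sos-6` g5, 2026-08-27; no data, no kernel decides — twenty lines of real analysis on top of the tree theorem (the force-balanced
twin is `EqSigmaR5.potentialEnergy_nonneg_Eq` of `Models/TearingFRS1EqSigmaAll.lean`).

THE STEP.  `I = ∫₀¹ ρ(ξ² + η² + ζ²)r dr ≥ 0` (`Sigma.kineticNorm_nonneg`).  If `W < 0`, take `σ² = −W/(2(I + 1)) > 0`: then
`W + σ²I ≤ W + σ²(I + 1) = W/2 < 0`, contradicting `sigmaModifiedEnergy_pos_all`.  Hence `W ≥ 0`.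

CERTIFIED (kernel): `potentialEnergy_nonneg_all` — for MODEL M and CLASS C (`ξ ∈ C¹(−2, 2)`, `ξ(1) = 0`, `ξ ≢ 0` on `(0, 1]`, finite energy
and norm) the Hain–Lüst potential energy of the `(2,1)` mode is `≥ 0`: THE IDEAL-MHD ENERGY PRINCIPLE HOLDS FOR THIS FOURIER MODE OF THIS
MODEL (GoedbloedPoedts2004 §6.5.3 (6.117) with `σ → 0`; marginal `W = 0` NOT excluded — the statement is `W ≥ 0`, not `W > 0`);
`growthRate_eq_zero_all` — a class-C displacement obeying the normal-mode identity `W = −γ²I` with `I > 0` has `γ = 0`.  HONESTY (three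
columns): ONE mode of ONE cylindrical model with the wall at the plasma; the resistive `(2,1)` tearing index of the same `q`-profile is
CERTIFIED positive (rows #13/#38) — «ideal energy principle satisfied / resistive Δ′ > 0», juxtaposed, never merged, never «MHD stable»; not
about any device.  No `native_decide`, no `sorry`; axioms standard.  [instance data]
-/

noncomputable section

open Set Literature.MathematicalPhysics.MHD

namespace Summit.Ventures.FusionMHD.Models.TearingFRS1.Sigma

/-- **THE ENERGY PRINCIPLE FOR THE `(2,1)` MODE OF MODEL M** (limit form of ★ #72, CERTIFIED): every class-C displacement of the mode
`(2, −1/5)` has `W ≥ 0` (`W + σ²I > 0` for every `σ ≠ 0` by `sigmaModifiedEnergy_pos_all`, `I ≥ 0`; choose `σ² = −W/(2(I+1))` if `W < 0`).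
Marginal `W = 0` not excluded; never «MHD stable»; not about any device. [instance data] -/
theorem potentialEnergy_nonneg_all {ξ η ζ : ℝ → ℝ}
    (hξ : ContDiffOn ℝ 1 ξ (Ioo (-2) 2)) (hξa : ξ 1 = 0) (hξne : ∃ r ∈ Ioc (0 : ℝ) 1, ξ r ≠ 0)
    (hW : IntervalIntegrable (dyn.potentialDensity 2 (-1 / 5) ξ η ζ) MeasureTheory.volume 0 1)
    (hI : IntervalIntegrable (dyn.kineticDensity ξ η ζ) MeasureTheory.volume 0 1) :
    0 ≤ dyn.potentialEnergy 2 (-1 / 5) 1 ξ η ζ := by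
  by_contra hneg
  rw [not_le] at hneg
  have hI0 : 0 ≤ dyn.kineticNorm 1 ξ η ζ := kineticNorm_nonneg ξ η ζ
  have hden : 0 < 2 * (dyn.kineticNorm 1 ξ η ζ + 1) := by linarith
  have hs0 : 0 < -dyn.potentialEnergy 2 (-1 / 5) 1 ξ η ζ / (2 * (dyn.kineticNorm 1 ξ η ζ + 1)) := div_pos (by linarith) hden
  have hσ : Real.sqrt (-dyn.potentialEnergy 2 (-1 / 5) 1 ξ η ζ / (2 * (dyn.kineticNorm 1 ξ η ζ + 1))) ≠ 0 :=
    (Real.sqrt_pos.mpr hs0).ne'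
  have h := sigmaModifiedEnergy_pos_all hσ hξ hξa hξne hW hI
  unfold ScrewPinch.DynProfile.sigmaModifiedEnergy at h
  rw [Real.sq_sqrt hs0.le] at h
  have e : -dyn.potentialEnergy 2 (-1 / 5) 1 ξ η ζ / (2 * (dyn.kineticNorm 1 ξ η ζ + 1)) * (2 * (dyn.kineticNorm 1 ξ η ζ + 1))
      = -dyn.potentialEnergy 2 (-1 / 5) 1 ξ η ζ := by
    field_simp
  nlinarith

/-- SPECTRAL READING (limit form): a class-C displacement of the `(2,1)` mode of MODEL M obeying the normal-mode energy identity `W = −γ²I`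
with `I > 0` has `γ = 0` — no exponential growth at ANY rate (the identity is a HYPOTHESIS; nothing is claimed about the existence of modes).
[instance data] -/
theorem growthRate_eq_zero_all {ξ η ζ : ℝ → ℝ}
    (hξ : ContDiffOn ℝ 1 ξ (Ioo (-2) 2)) (hξa : ξ 1 = 0) (hξne : ∃ r ∈ Ioc (0 : ℝ) 1, ξ r ≠ 0)
    (hW : IntervalIntegrable (dyn.potentialDensity 2 (-1 / 5) ξ η ζ) MeasureTheory.volume 0 1)
    (hI : IntervalIntegrable (dyn.kineticDensity ξ η ζ) MeasureTheory.volume 0 1)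
    {γ : ℝ} (hmode : dyn.potentialEnergy 2 (-1 / 5) 1 ξ η ζ = -γ ^ 2 * dyn.kineticNorm 1 ξ η ζ)
    (hIpos : 0 < dyn.kineticNorm 1 ξ η ζ) : γ = 0 := by
  have hW0 := potentialEnergy_nonneg_all hξ hξa hξne hW hI
  rw [hmode] at hW0
  have hγ2 : γ ^ 2 ≤ 0 := by nlinarith
  exact pow_eq_zero_iff (n := 2) (by norm_num) |>.mp (le_antisymm hγ2 (sq_nonneg γ))

end Summit.Ventures.FusionMHD.Models.TearingFRS1.Sigma

end
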